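import Summits.QuantumFields.YangMills.Theorems.LuscherReductionDressedRitzPolyakovLiftBlockPositionGluePair
import HarnessLib

/-!
# Route `LuscherReduction`, item `DressedRitz` (stmt-QuantumFields-20205), line «polyakovlift» r8 — ★★ THE DYNAMIC CORE (o5)(o6) OF A DRESSED FAMILY FROM
# BLOCK DATA through the block-to-fine doors (LEAD prover ym-lead-20205-polyakovlift g4; `--supports stmt-QuantumFields-20205`)

Per-basis theorem (fixed lattice `L`, coupling `β > 0`, raw vacuum `φ`, basis `g`; `v_i = liftVec β φ g_i`, `u_i = dressedLiftFamily β φ g i = K^{L} v_i`, block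
`P = K^{L}`): the FINE dynamic core `DynamicCoreClauses k C β u` — (o5) at `e^{Cλ²/L}`, (o6) at `C(λ²/L)λ₀‖u_i‖‖u_l‖` — follows from
* the block defects of `v_i` (raw) and `u_i` (dressed) `≤ δ ≤ 1/32` (text `BlockLeakageForL`),
* BLOCK POSITION (B5) at `e^{a}` and (B6) at `E·λ₀^L` (text `BlockPositionForL`),
* STATICS (o2) `|⟨u_i,u_l⟩| ≤ s‖u_i‖‖u_l‖` (text `StaticsForL`),
* SIDE CONDITIONS on the block Rayleigh quotients `X_i = ⟨u_i,Pu_i⟩/‖u_i‖²`: comparability `X_i ≤ Θ₁X_l`, mismatch `|X_i − X_l| ≤ ηX_l` (`η ≤ 1`), top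
  `λ₀^L ≤ Θ₁X_i` — consequences of (B5) and the one-site level package of the closed crux ONE (`PScal.levels_package`: `(μ_j/μ_0)^L = e^{−(ε_{j+1}−ε_1)λ ± O(λ²/L)}`),
  to be discharged in the `…ForL` assembly (next file, w1a WAKE W4-A),
provided `a + 15δ ≤ Cλ²` and `2Θ₁E + 2Θ₁(η+15δ)s + (512Θ₁⁴+16Θ₁)δ + 512Θ₁²(η+15δ)² ≤ Cλ²`:

* ★ `o5_clause` (root extraction), ★ `o6_clause` (cross door + triangle), ★★ `dynamicCoreClauses_of_block` (assembly); pure-real side lemmas in part A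
  (`…BlockPositionGluePair.lean`: `pair_centre`, `quot_pow_bounds`, `o6_numeric`).

HONEST FRAMING: door algebra on a fixed lattice for the CONDITIONAL femto rung R2b1; every block text it consumes is an OPEN renormalisation-group estimate; nothing here
bears on infinite volume, the continuum limit or the Clay gap.  References: M. Lüscher, NPB 219 (1983) 233 [cite: Luscher1983, §3]; Lüscher–Wolff [cite: LuscherWolff1990].
-/

set_option autoImplicit false

noncomputable section

open MeasureTheory Filter Topology Real
open Literature.MathematicalPhysics.QuantumFieldTheory (GaugeConfig Site gaugeTransform)
open scoped BigOperators

namespace Summit.QuantumFields.YangMills.Theorems.FemtoTransferGap.PolyakovLift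

open Summit.QuantumFields.YangMills.Theorems.FemtoTransferGap

variable {L : ℕ} [NeZero L]

/-! ## §2 ★ (o5) for one channel -/

/-- ★ **(o5) CLAUSE for one dressed channel** `u = K^{L'} v` (`L' = dressSteps L`), from its raw/dressed block defects `≤ δ`, the block position (B5) at `e^{a}`, and
`a + 15δ ≤ Cλ²`. [cite: Luscher1983, §3] -/
theorem o5_clause {β : ℝ} (hβ : 0 < β) {v : GaugeConfig 3 L SU2 → ℝ} (hv : IsPhys v) {δ a C m0 μ : ℝ}
    (hδ0 : 0 ≤ δ) (hδ : δ ≤ 1 / 32) (hm0 : 0 < m0) (hμ : 0 ≤ μ)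
    (hn : 0 < l2 ((transferApply β)^[dressSteps L] v) ((transferApply β)^[dressSteps L] v))
    (hraw : l2 v ((transferApply β)^[2 * dressSteps L] v) * l2 v v ≤ (1 + δ) * l2 v ((transferApply β)^[dressSteps L] v) ^ 2)
    (hdress : l2 ((transferApply β)^[dressSteps L] v) ((transferApply β)^[2 * dressSteps L] ((transferApply β)^[dressSteps L] v)) *
        l2 ((transferApply β)^[dressSteps L] v) ((transferApply β)^[dressSteps L] v) ≤
      (1 + δ) * l2 ((transferApply β)^[dressSteps L] v) ((transferApply β)^[dressSteps L] ((transferApply β)^[dressSteps L] v)) ^ 2)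
    (hB5 : l2 ((transferApply β)^[dressSteps L] v) ((transferApply β)^[dressSteps L] ((transferApply β)^[dressSteps L] v)) * m0 ^ dressSteps L ≤
        Real.exp a * (μ * levelValue su2Rep L β 0) ^ dressSteps L * l2 ((transferApply β)^[dressSteps L] v) ((transferApply β)^[dressSteps L] v) ∧
      (μ * levelValue su2Rep L β 0) ^ dressSteps L * l2 ((transferApply β)^[dressSteps L] v) ((transferApply β)^[dressSteps L] v) ≤
        Real.exp a * (l2 ((transferApply β)^[dressSteps L] v) ((transferApply β)^[dressSteps L] ((transferApply β)^[dressSteps L] v)) * m0 ^ dressSteps L))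
    (hC5 : a + 15 * δ ≤ C * luscherLambda β L ^ 2) :
    l2 ((transferApply β)^[dressSteps L] v) (transferApply β ((transferApply β)^[dressSteps L] v)) * m0 ≤
        Real.exp (C * luscherLambda β L ^ 2 / L) * (μ * levelValue su2Rep L β 0) *
          l2 ((transferApply β)^[dressSteps L] v) ((transferApply β)^[dressSteps L] v) ∧
      μ * levelValue su2Rep L β 0 * l2 ((transferApply β)^[dressSteps L] v) ((transferApply β)^[dressSteps L] v) ≤
        Real.exp (C * luscherLambda β L ^ 2 / L) * (l2 ((transferApply β)^[dressSteps L] v) (transferApply β ((transferApply β)^[dressSteps L] v)) * m0) := by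
  have hL1 : 1 ≤ dressSteps L := (NeZero.one_le : 1 ≤ L)
  have hLr : (0 : ℝ) < (dressSteps L : ℕ) := by exact_mod_cast hL1
  have hLL : ((dressSteps L : ℕ) : ℝ) = (L : ℝ) := rfl
  have hA := BlockToFine.jensen_root hβ hv hL1
  have hB := BlockToFine.reverse_jensen_root hβ hv hL1 hδ0 hδ hn hraw hdress
  have hl0 : 0 ≤ levelValue su2Rep L β 0 := levelValue_su2Rep_nonneg L hβ.le 0
  have hd0 : 0 ≤ l2 ((transferApply β)^[dressSteps L] v) (transferApply β ((transferApply β)^[dressSteps L] v)) := by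
    rw [← qform_eq_l2_transferApply]; exact qform_su2Rep_self_nonneg hβ.le (isPhys_iterate_transferApply β hv _)
  obtain ⟨h1, h2⟩ := o5_of_block hL1 hd0 hn hm0 hμ hl0 hA hB hB5.1 hB5.2
  have ha15 : 0 ≤ 15 * δ := by positivity
  have he1 : Real.exp (a / (dressSteps L : ℕ)) ≤ Real.exp (C * luscherLambda β L ^ 2 / L) := by
    rw [hLL]; exact Real.exp_le_exp.2 (div_le_div_of_nonneg_right (by linarith) (by rw [← hLL]; exact hLr.le))
  have he2 : Real.exp ((a + 15 * δ) / (dressSteps L : ℕ)) ≤ Real.exp (C * luscherLambda β L ^ 2 / L) := by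
    rw [hLL]; exact Real.exp_le_exp.2 (div_le_div_of_nonneg_right hC5 (by rw [← hLL]; exact hLr.le))
  constructor
  · exact le_trans h1 (mul_le_mul_of_nonneg_right (mul_le_mul_of_nonneg_right he1 (mul_nonneg hμ hl0)) hn.le)
  · exact le_trans h2 (mul_le_mul_of_nonneg_right he2 (mul_nonneg hd0 hm0.le))

/-- ★★ **(o6) CLAUSE for a pair of dressed channels** `u = K^{L'}v`, `u' = K^{L'}w` (`L' = dressSteps L`): from the raw/dressed block defects `≤ δ` of both, the block
cross clause (B6) at `E·λ₀^{L'}`, statics (o2) `|⟨u,u'⟩| ≤ s‖u‖‖u'‖`, the side conditions on the block quotients (comparability `Θ₁`, mismatch `η`, top), and the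
budget `2Θ₁E + 2Θ₁(η+15δ)s + (32(2Θ₁)⁴+8(2Θ₁))δ + 128(2Θ₁)²(η+15δ)² ≤ Cλ²`:  the fine symmetrised coupling obeys (o6) at `C(λ²/L)λ₀‖u‖‖u'‖`.
[cite: Luscher1983, §3] [cite: LuscherWolff1990] -/
theorem o6_clause {β : ℝ} (hβ : 0 < β) {v w : GaugeConfig 3 L SU2 → ℝ} (hv : IsPhys v) (hw : IsPhys w) {δ E s Θ₁ η C : ℝ}
    (hδ0 : 0 ≤ δ) (hδ : δ ≤ 1 / 32) (hE : 0 ≤ E) (hs : 0 ≤ s) (hΘ₁ : 1 ≤ Θ₁) (hη0 : 0 ≤ η)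
    (hn : 0 < l2 ((transferApply β)^[dressSteps L] v) ((transferApply β)^[dressSteps L] v))
    (hn' : 0 < l2 ((transferApply β)^[dressSteps L] w) ((transferApply β)^[dressSteps L] w))
    (hrawv : l2 v ((transferApply β)^[2 * dressSteps L] v) * l2 v v ≤ (1 + δ) * l2 v ((transferApply β)^[dressSteps L] v) ^ 2)
    (hdressv : l2 ((transferApply β)^[dressSteps L] v) ((transferApply β)^[2 * dressSteps L] ((transferApply β)^[dressSteps L] v)) *
        l2 ((transferApply β)^[dressSteps L] v) ((transferApply β)^[dressSteps L] v) ≤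
      (1 + δ) * l2 ((transferApply β)^[dressSteps L] v) ((transferApply β)^[dressSteps L] ((transferApply β)^[dressSteps L] v)) ^ 2)
    (hraww : l2 w ((transferApply β)^[2 * dressSteps L] w) * l2 w w ≤ (1 + δ) * l2 w ((transferApply β)^[dressSteps L] w) ^ 2)
    (hdressw : l2 ((transferApply β)^[dressSteps L] w) ((transferApply β)^[2 * dressSteps L] ((transferApply β)^[dressSteps L] w)) *
        l2 ((transferApply β)^[dressSteps L] w) ((transferApply β)^[dressSteps L] w) ≤
      (1 + δ) * l2 ((transferApply β)^[dressSteps L] w) ((transferApply β)^[dressSteps L] ((transferApply β)^[dressSteps L] w)) ^ 2)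
    (hB6 : |l2 ((transferApply β)^[dressSteps L] v) ((transferApply β)^[dressSteps L] ((transferApply β)^[dressSteps L] w)) -
        (l2 ((transferApply β)^[dressSteps L] v) ((transferApply β)^[dressSteps L] ((transferApply β)^[dressSteps L] v)) /
              l2 ((transferApply β)^[dressSteps L] v) ((transferApply β)^[dressSteps L] v) +
          l2 ((transferApply β)^[dressSteps L] w) ((transferApply β)^[dressSteps L] ((transferApply β)^[dressSteps L] w)) /
              l2 ((transferApply β)^[dressSteps L] w) ((transferApply β)^[dressSteps L] w)) / 2 *
          l2 ((transferApply β)^[dressSteps L] v) ((transferApply β)^[dressSteps L] w)| ≤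
      E * levelValue su2Rep L β 0 ^ dressSteps L *
        (Real.sqrt (l2 ((transferApply β)^[dressSteps L] v) ((transferApply β)^[dressSteps L] v)) *
          Real.sqrt (l2 ((transferApply β)^[dressSteps L] w) ((transferApply β)^[dressSteps L] w))))
    (ho2 : |l2 ((transferApply β)^[dressSteps L] v) ((transferApply β)^[dressSteps L] w)| ≤
      s * (Real.sqrt (l2 ((transferApply β)^[dressSteps L] v) ((transferApply β)^[dressSteps L] v)) *
        Real.sqrt (l2 ((transferApply β)^[dressSteps L] w) ((transferApply β)^[dressSteps L] w))))
    (hcmp : l2 ((transferApply β)^[dressSteps L] v) ((transferApply β)^[dressSteps L] ((transferApply β)^[dressSteps L] v)) /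
        l2 ((transferApply β)^[dressSteps L] v) ((transferApply β)^[dressSteps L] v) ≤
      Θ₁ * (l2 ((transferApply β)^[dressSteps L] w) ((transferApply β)^[dressSteps L] ((transferApply β)^[dressSteps L] w)) /
        l2 ((transferApply β)^[dressSteps L] w) ((transferApply β)^[dressSteps L] w)))
    (hcmp' : l2 ((transferApply β)^[dressSteps L] w) ((transferApply β)^[dressSteps L] ((transferApply β)^[dressSteps L] w)) /
        l2 ((transferApply β)^[dressSteps L] w) ((transferApply β)^[dressSteps L] w) ≤
      Θ₁ * (l2 ((transferApply β)^[dressSteps L] v) ((transferApply β)^[dressSteps L] ((transferApply β)^[dressSteps L] v)) /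
        l2 ((transferApply β)^[dressSteps L] v) ((transferApply β)^[dressSteps L] v)))
    (hmis : |l2 ((transferApply β)^[dressSteps L] v) ((transferApply β)^[dressSteps L] ((transferApply β)^[dressSteps L] v)) /
          l2 ((transferApply β)^[dressSteps L] v) ((transferApply β)^[dressSteps L] v) -
        l2 ((transferApply β)^[dressSteps L] w) ((transferApply β)^[dressSteps L] ((transferApply β)^[dressSteps L] w)) /
          l2 ((transferApply β)^[dressSteps L] w) ((transferApply β)^[dressSteps L] w)| ≤
      η * (l2 ((transferApply β)^[dressSteps L] w) ((transferApply β)^[dressSteps L] ((transferApply β)^[dressSteps L] w)) /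
          l2 ((transferApply β)^[dressSteps L] w) ((transferApply β)^[dressSteps L] w)))
    (hmis' : |l2 ((transferApply β)^[dressSteps L] w) ((transferApply β)^[dressSteps L] ((transferApply β)^[dressSteps L] w)) /
          l2 ((transferApply β)^[dressSteps L] w) ((transferApply β)^[dressSteps L] w) -
        l2 ((transferApply β)^[dressSteps L] v) ((transferApply β)^[dressSteps L] ((transferApply β)^[dressSteps L] v)) /
          l2 ((transferApply β)^[dressSteps L] v) ((transferApply β)^[dressSteps L] v)| ≤
      η * (l2 ((transferApply β)^[dressSteps L] v) ((transferApply β)^[dressSteps L] ((transferApply β)^[dressSteps L] v)) /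
          l2 ((transferApply β)^[dressSteps L] v) ((transferApply β)^[dressSteps L] v)))
    (htopv : levelValue su2Rep L β 0 ^ dressSteps L ≤
      Θ₁ * (l2 ((transferApply β)^[dressSteps L] v) ((transferApply β)^[dressSteps L] ((transferApply β)^[dressSteps L] v)) /
        l2 ((transferApply β)^[dressSteps L] v) ((transferApply β)^[dressSteps L] v)))
    (htopw : levelValue su2Rep L β 0 ^ dressSteps L ≤
      Θ₁ * (l2 ((transferApply β)^[dressSteps L] w) ((transferApply β)^[dressSteps L] ((transferApply β)^[dressSteps L] w)) /
        l2 ((transferApply β)^[dressSteps L] w) ((transferApply β)^[dressSteps L] w)))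
    (hC6 : 2 * Θ₁ * E + 2 * Θ₁ * (η + 15 * δ) * s +
        ((32 * (2 * Θ₁) ^ 4 + 8 * (2 * Θ₁)) * δ + 128 * (2 * Θ₁) ^ 2 * (η + 15 * δ) ^ 2) ≤ C * luscherLambda β L ^ 2) :
    |l2 ((transferApply β)^[dressSteps L] v) (transferApply β ((transferApply β)^[dressSteps L] w)) -
        (l2 ((transferApply β)^[dressSteps L] v) (transferApply β ((transferApply β)^[dressSteps L] v)) /
              l2 ((transferApply β)^[dressSteps L] v) ((transferApply β)^[dressSteps L] v) +
          l2 ((transferApply β)^[dressSteps L] w) (transferApply β ((transferApply β)^[dressSteps L] w)) /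
              l2 ((transferApply β)^[dressSteps L] w) ((transferApply β)^[dressSteps L] w)) / 2 *
          l2 ((transferApply β)^[dressSteps L] v) ((transferApply β)^[dressSteps L] w)| ≤
      C * (luscherLambda β L ^ 2 / L) * levelValue su2Rep L β 0 *
        (Real.sqrt (l2 ((transferApply β)^[dressSteps L] v) ((transferApply β)^[dressSteps L] v)) *
          Real.sqrt (l2 ((transferApply β)^[dressSteps L] w) ((transferApply β)^[dressSteps L] w))) := by
  -- names
  have hL1 : 1 ≤ dressSteps L := (NeZero.one_le : 1 ≤ L)
  have hLr : (0 : ℝ) < (dressSteps L : ℕ) := by exact_mod_cast hL1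
  have hLL : ((dressSteps L : ℕ) : ℝ) = (L : ℝ) := rfl
  set n := l2 ((transferApply β)^[dressSteps L] v) ((transferApply β)^[dressSteps L] v) with hndef
  set n' := l2 ((transferApply β)^[(dressSteps L)] w) ((transferApply β)^[(dressSteps L)] w) with hn'def
  set d := l2 ((transferApply β)^[(dressSteps L)] v) ((transferApply β) ((transferApply β)^[(dressSteps L)] v)) with hddef
  set d' := l2 ((transferApply β)^[(dressSteps L)] w) ((transferApply β) ((transferApply β)^[(dressSteps L)] w)) with hd'def
  set Xt := l2 ((transferApply β)^[(dressSteps L)] v) ((transferApply β)^[(dressSteps L)] ((transferApply β)^[(dressSteps L)] v)) with hXt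
  set Xt' := l2 ((transferApply β)^[(dressSteps L)] w) ((transferApply β)^[(dressSteps L)] ((transferApply β)^[(dressSteps L)] w)) with hXt'
  set l0 := levelValue su2Rep L β 0 with hl0
  set q := Real.sqrt n * Real.sqrt n' with hqdef
  have hl0pos : 0 < l0 := levelValue_su2Rep_pos (L := L) hβ 0
  have hq0 : 0 ≤ q := by positivity
  -- iterate identities
  have e1v : (transferApply β)^[(dressSteps L) + 1] v = (transferApply β) ((transferApply β)^[(dressSteps L)] v) := Function.iterate_succ_apply' (transferApply β) (dressSteps L) v
  have e1w : (transferApply β)^[(dressSteps L) + 1] w = (transferApply β) ((transferApply β)^[(dressSteps L)] w) := Function.iterate_succ_apply' (transferApply β) (dressSteps L) w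
  have e2v : (transferApply β)^[(dressSteps L)] ((transferApply β)^[(dressSteps L)] v) = (transferApply β)^[2 * (dressSteps L)] v := by rw [← Function.iterate_add_apply, show (dressSteps L) + (dressSteps L) = 2 * (dressSteps L) by ring]
  have e2w : (transferApply β)^[(dressSteps L)] ((transferApply β)^[(dressSteps L)] w) = (transferApply β)^[2 * (dressSteps L)] w := by rw [← Function.iterate_add_apply, show (dressSteps L) + (dressSteps L) = 2 * (dressSteps L) by ring]
  have e3v : (transferApply β)^[2 * (dressSteps L)] ((transferApply β)^[(dressSteps L)] v) = (transferApply β)^[3 * (dressSteps L)] v := by rw [← Function.iterate_add_apply, show 2 * (dressSteps L) + (dressSteps L) = 3 * (dressSteps L) by ring]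
  have e3w : (transferApply β)^[2 * (dressSteps L)] ((transferApply β)^[(dressSteps L)] w) = (transferApply β)^[3 * (dressSteps L)] w := by rw [← Function.iterate_add_apply, show 2 * (dressSteps L) + (dressSteps L) = 3 * (dressSteps L) by ring]
  -- doors (a)(b) for both, quotient form
  have hAv := BlockToFine.jensen_root hβ hv hL1
  have hBv := BlockToFine.reverse_jensen_root hβ hv hL1 hδ0 hδ hn hrawv hdressv
  have hAw := BlockToFine.jensen_root hβ hw hL1
  have hBw := BlockToFine.reverse_jensen_root hβ hw hL1 hδ0 hδ hn' hraww hdressw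
  obtain ⟨hyv2, hyv1⟩ := quot_pow_bounds hL1 hn hAv hBv
  obtain ⟨hyw2, hyw1⟩ := quot_pow_bounds hL1 hn' hAw hBw
  -- Rayleigh d ≤ l0 n
  have hd0 : 0 ≤ d := by rw [hddef, ← qform_eq_l2_transferApply]; exact qform_su2Rep_self_nonneg hβ.le (isPhys_iterate_transferApply β hv _)
  have hd'0 : 0 ≤ d' := by rw [hd'def, ← qform_eq_l2_transferApply]; exact qform_su2Rep_self_nonneg hβ.le (isPhys_iterate_transferApply β hw _)
  obtain ⟨-, -, -, -, -, -, -, -, -, -, -, -, hrayv⟩ := BlockToFine.exists_root_data hβ hv hL1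
  obtain ⟨-, -, -, -, -, -, -, -, -, -, -, -, hrayw⟩ := BlockToFine.exists_root_data hβ hw hL1
  rw [e1v] at hrayv
  rw [e1w] at hrayw
  have hyv : 0 ≤ d / n := div_nonneg hd0 hn.le
  have hyw : 0 ≤ d' / n' := div_nonneg hd'0 hn'.le
  have hyvl0 : d / n ≤ l0 := by rw [div_le_iff₀ hn]; exact hrayv
  have hywl0 : d' / n' ≤ l0 := by rw [div_le_iff₀ hn']; exact hrayw
  -- block quotients positive (from the top condition)
  have hΘpos : 0 < Θ₁ := by linarith
  have hXqv : 0 < Xt / n := (mul_pos_iff_of_pos_left hΘpos).1 (lt_of_lt_of_le (pow_pos hl0pos _) htopv)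
  have hXqw : 0 < Xt' / n' := (mul_pos_iff_of_pos_left hΘpos).1 (lt_of_lt_of_le (pow_pos hl0pos _) htopw)
  -- the pair's centre
  obtain ⟨hX0pos, hX1, hX2, hX1', hX2', hT, hmm, hmm', hcen⟩ :=
    pair_centre (T := l0 ^ (dressSteps L)) hXqv hXqw hyv hyw hΘ₁ hη0 hδ0 hδ hyv1 hyv2 hyw1 hyw2 hcmp hcmp' hmis hmis' htopv htopw
  set mb := (d / n + d' / n') / 2 with hmbdef
  set X0 := mb ^ (dressSteps L) with hX0def
  have hmb0 : 0 ≤ mb := by rw [hmbdef]; positivity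
  have hmbl0 : mb ≤ l0 := by rw [hmbdef]; linarith
  have hΘ2 : 1 ≤ 2 * Θ₁ := by linarith
  -- the cross door (τ = √n'/√n)
  have hsn : 0 < Real.sqrt n := Real.sqrt_pos.2 hn
  have hsn' : 0 < Real.sqrt n' := Real.sqrt_pos.2 hn'
  set τ := Real.sqrt n' / Real.sqrt n with hτdef
  have hτ : 0 < τ := div_pos hsn' hsn
  have hdress3v : l2 ((transferApply β)^[(dressSteps L)] v) ((transferApply β)^[3 * (dressSteps L)] v) * n ≤ (1 + δ) * l2 ((transferApply β)^[(dressSteps L)] v) ((transferApply β)^[2 * (dressSteps L)] v) ^ 2 := by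
    rw [← e3v, ← e2v]; exact hdressv
  have hdress3w : l2 ((transferApply β)^[(dressSteps L)] w) ((transferApply β)^[3 * (dressSteps L)] w) * n' ≤ (1 + δ) * l2 ((transferApply β)^[(dressSteps L)] w) ((transferApply β)^[2 * (dressSteps L)] w) ^ 2 := by
    rw [← e3w, ← e2w]; exact hdressw
  have hdoor := BlockToFine.cross_door (Θ := 2 * Θ₁) hβ hv hw hL1 hδ0 hδ hΘ2 hτ hn hn' hrawv hdress3v hraww hdress3w
    (by rw [e1v, e1w, ← e2v]; exact hX1) (by rw [e1v, e1w, ← e2v]; exact hX2)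
    (by rw [e1v, e1w, ← e2w]; exact hX1') (by rw [e1v, e1w, ← e2w]; exact hX2')
    (by rw [e1v, e1w]; exact hT)
  simp only [e1v, e1w, ← e2v, ← e2w] at hdoor
  -- triangle
  have hF : |X0 - (Xt / n + Xt' / n') / 2| * |l2 ((transferApply β)^[(dressSteps L)] v) ((transferApply β)^[(dressSteps L)] w)| ≤ (η + 15 * δ) * (2 * Θ₁) * X0 * (s * q) :=
    mul_le_mul hcen ho2 (abs_nonneg _) (by positivity)
  have hκ : 0 ≤ mb / ((dressSteps L) * X0) := by positivity
  have htri := o6_of_block hκ hdoor hB6 hF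
  -- numeric end-game
  have hss : Real.sqrt n * Real.sqrt n = n := Real.mul_self_sqrt hn.le
  have hss' : Real.sqrt n' * Real.sqrt n' = n' := Real.mul_self_sqrt hn'.le
  have hτn : τ * n = q := by
    rw [hτdef, hqdef, div_mul_eq_mul_div, div_eq_iff hsn.ne']
    linear_combination (-(Real.sqrt n')) * hss
  have hτn' : n' / τ = q := by
    rw [hτdef, hqdef, div_div_eq_mul_div, div_eq_iff hsn'.ne']
    linear_combination (-(Real.sqrt n)) * hss'
  have hR2a : τ * n * ((32 * (2 * Θ₁) ^ 4 + 8 * (2 * Θ₁)) * δ + 32 * (2 * Θ₁) ^ 2 * (Xt / n / X0 - 1) ^ 2) =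
      q * ((32 * (2 * Θ₁) ^ 4 + 8 * (2 * Θ₁)) * δ + 32 * (2 * Θ₁) ^ 2 * (Xt / n / X0 - 1) ^ 2) := by rw [hτn]
  have hR2b : n' * ((32 * (2 * Θ₁) ^ 4 + 8 * (2 * Θ₁)) * δ + 32 * (2 * Θ₁) ^ 2 * (Xt' / n' / X0 - 1) ^ 2) / τ =
      q * ((32 * (2 * Θ₁) ^ 4 + 8 * (2 * Θ₁)) * δ + 32 * (2 * Θ₁) ^ 2 * (Xt' / n' / X0 - 1) ^ 2) := by
    rw [← hτn']; ring
  have hR2 : mb / (2 * (dressSteps L)) *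
      (τ * n * ((32 * (2 * Θ₁) ^ 4 + 8 * (2 * Θ₁)) * δ + 32 * (2 * Θ₁) ^ 2 * (Xt / n / X0 - 1) ^ 2) +
        n' * ((32 * (2 * Θ₁) ^ 4 + 8 * (2 * Θ₁)) * δ + 32 * (2 * Θ₁) ^ 2 * (Xt' / n' / X0 - 1) ^ 2) / τ) =
      mb / (2 * (dressSteps L)) *
      (q * ((32 * (2 * Θ₁) ^ 4 + 8 * (2 * Θ₁)) * δ + 32 * (2 * Θ₁) ^ 2 * (Xt / n / X0 - 1) ^ 2) +
        q * ((32 * (2 * Θ₁) ^ 4 + 8 * (2 * Θ₁)) * δ + 32 * (2 * Θ₁) ^ 2 * (Xt' / n' / X0 - 1) ^ 2)) := by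
    rw [hR2a, hR2b]
  have hΦv : (32 * (2 * Θ₁) ^ 4 + 8 * (2 * Θ₁)) * δ + 32 * (2 * Θ₁) ^ 2 * (Xt / n / X0 - 1) ^ 2 ≤
      (32 * (2 * Θ₁) ^ 4 + 8 * (2 * Θ₁)) * δ + 32 * (2 * Θ₁) ^ 2 * (4 * (η + 15 * δ) ^ 2) := by
    have := mul_le_mul_of_nonneg_left hmm (by positivity : (0 : ℝ) ≤ 32 * (2 * Θ₁) ^ 2); linarith
  have hΦw : (32 * (2 * Θ₁) ^ 4 + 8 * (2 * Θ₁)) * δ + 32 * (2 * Θ₁) ^ 2 * (Xt' / n' / X0 - 1) ^ 2 ≤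
      (32 * (2 * Θ₁) ^ 4 + 8 * (2 * Θ₁)) * δ + 32 * (2 * Θ₁) ^ 2 * (4 * (η + 15 * δ) ^ 2) := by
    have := mul_le_mul_of_nonneg_left hmm' (by positivity : (0 : ℝ) ≤ 32 * (2 * Θ₁) ^ 2); linarith
  have hnum := o6_numeric (C := C) (lam2 := luscherLambda β L ^ 2) hmb0 hmbl0 hLr hX0pos hT hE hs hη0 hδ0 hΘ₁ hq0
    hΦv hΦw rfl hR2 hC6
  rw [hLL] at hnum
  exact le_trans htri hnum

/-! ## §4 ★★ Assembly: the dynamic core of the dressed lifted family from block data -/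

/-- ★★ **`DynamicCoreClauses` FROM BLOCK DATA.**  For a dressed lifted family `u = dressedLiftFamily β φ g` (`u_i = K^{L'}v_i`, `v_i = liftVec β φ g_i`,
`L' = dressSteps L`) whose channels have raw/dressed block defects `≤ δ ≤ 1/32`, block position (B5) at `e^{a}`, block cross data (B6) at `E·λ₀^{L'}`, statics
(o2) at `s`, and block quotients that are `Θ₁`-comparable, `η`-close and `Θ₁`-below-top, with the two budgets `a + 15δ ≤ Cλ²` and
`2Θ₁E + 2Θ₁(η+15δ)s + (32(2Θ₁)⁴+8(2Θ₁))δ + 128(2Θ₁)²(η+15δ)² ≤ Cλ²`: the FINE dynamic core holds, `DynamicCoreClauses k C β u`.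
[cite: Luscher1983, §3] [cite: LuscherWolff1990] -/
theorem dynamicCoreClauses_of_block {k : ℕ} {β : ℝ} (hβ : 0 < β) {φ : GaugeConfig 3 L SU2 → ℝ} {g : Fin k → (GaugeConfig 3 1 SU2 → ℝ)}
    (hv : ∀ i, IsPhys (liftVec β φ (g i))) {δ a E s Θ₁ η C : ℝ}
    (hδ0 : 0 ≤ δ) (hδ : δ ≤ 1 / 32) (hE : 0 ≤ E) (hs : 0 ≤ s) (hΘ₁ : 1 ≤ Θ₁) (hη0 : 0 ≤ η)
    (hB : 0 < oneSiteCoupling β L)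
    (hn : ∀ i, 0 < l2 (dressedLiftFamily β φ g i) (dressedLiftFamily β φ g i))
    (hraw : ∀ i, l2 (liftVec β φ (g i)) ((transferApply β)^[2 * dressSteps L] (liftVec β φ (g i))) * l2 (liftVec β φ (g i)) (liftVec β φ (g i)) ≤
      (1 + δ) * l2 (liftVec β φ (g i)) ((transferApply β)^[dressSteps L] (liftVec β φ (g i))) ^ 2)
    (hdress : ∀ i, l2 (dressedLiftFamily β φ g i) ((transferApply β)^[2 * dressSteps L] (dressedLiftFamily β φ g i)) *
        l2 (dressedLiftFamily β φ g i) (dressedLiftFamily β φ g i) ≤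
      (1 + δ) * l2 (dressedLiftFamily β φ g i) ((transferApply β)^[dressSteps L] (dressedLiftFamily β φ g i)) ^ 2)
    (hB5 : ∀ i : Fin k,
      l2 (dressedLiftFamily β φ g i) ((transferApply β)^[dressSteps L] (dressedLiftFamily β φ g i)) *
          levelValue su2Rep 1 (oneSiteCoupling β L) 0 ^ dressSteps L ≤
        Real.exp a * (levelValue su2Rep 1 (oneSiteCoupling β L) ((i : ℕ) + 1) * levelValue su2Rep L β 0) ^ dressSteps L *
          l2 (dressedLiftFamily β φ g i) (dressedLiftFamily β φ g i) ∧
      (levelValue su2Rep 1 (oneSiteCoupling β L) ((i : ℕ) + 1) * levelValue su2Rep L β 0) ^ dressSteps L *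
          l2 (dressedLiftFamily β φ g i) (dressedLiftFamily β φ g i) ≤
        Real.exp a * (l2 (dressedLiftFamily β φ g i) ((transferApply β)^[dressSteps L] (dressedLiftFamily β φ g i)) *
          levelValue su2Rep 1 (oneSiteCoupling β L) 0 ^ dressSteps L))
    (hB6 : ∀ i l : Fin k, i ≠ l →
      |l2 (dressedLiftFamily β φ g i) ((transferApply β)^[dressSteps L] (dressedLiftFamily β φ g l)) -
          (l2 (dressedLiftFamily β φ g i) ((transferApply β)^[dressSteps L] (dressedLiftFamily β φ g i)) /
                l2 (dressedLiftFamily β φ g i) (dressedLiftFamily β φ g i) +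
            l2 (dressedLiftFamily β φ g l) ((transferApply β)^[dressSteps L] (dressedLiftFamily β φ g l)) /
                l2 (dressedLiftFamily β φ g l) (dressedLiftFamily β φ g l)) / 2 *
            l2 (dressedLiftFamily β φ g i) (dressedLiftFamily β φ g l)| ≤
        E * levelValue su2Rep L β 0 ^ dressSteps L *
          (Real.sqrt (l2 (dressedLiftFamily β φ g i) (dressedLiftFamily β φ g i)) * Real.sqrt (l2 (dressedLiftFamily β φ g l) (dressedLiftFamily β φ g l))))
    (ho2 : ∀ i l : Fin k, i ≠ l → |l2 (dressedLiftFamily β φ g i) (dressedLiftFamily β φ g l)| ≤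
        s * (Real.sqrt (l2 (dressedLiftFamily β φ g i) (dressedLiftFamily β φ g i)) * Real.sqrt (l2 (dressedLiftFamily β φ g l) (dressedLiftFamily β φ g l))))
    (hcmp : ∀ i l : Fin k,
      l2 (dressedLiftFamily β φ g i) ((transferApply β)^[dressSteps L] (dressedLiftFamily β φ g i)) / l2 (dressedLiftFamily β φ g i) (dressedLiftFamily β φ g i) ≤
        Θ₁ * (l2 (dressedLiftFamily β φ g l) ((transferApply β)^[dressSteps L] (dressedLiftFamily β φ g l)) /
          l2 (dressedLiftFamily β φ g l) (dressedLiftFamily β φ g l)))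
    (hmis : ∀ i l : Fin k,
      |l2 (dressedLiftFamily β φ g i) ((transferApply β)^[dressSteps L] (dressedLiftFamily β φ g i)) / l2 (dressedLiftFamily β φ g i) (dressedLiftFamily β φ g i) -
          l2 (dressedLiftFamily β φ g l) ((transferApply β)^[dressSteps L] (dressedLiftFamily β φ g l)) / l2 (dressedLiftFamily β φ g l) (dressedLiftFamily β φ g l)| ≤
        η * (l2 (dressedLiftFamily β φ g l) ((transferApply β)^[dressSteps L] (dressedLiftFamily β φ g l)) /
          l2 (dressedLiftFamily β φ g l) (dressedLiftFamily β φ g l)))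
    (htop : ∀ i : Fin k, levelValue su2Rep L β 0 ^ dressSteps L ≤
      Θ₁ * (l2 (dressedLiftFamily β φ g i) ((transferApply β)^[dressSteps L] (dressedLiftFamily β φ g i)) /
        l2 (dressedLiftFamily β φ g i) (dressedLiftFamily β φ g i)))
    (hC5 : a + 15 * δ ≤ C * luscherLambda β L ^ 2)
    (hC6 : 2 * Θ₁ * E + 2 * Θ₁ * (η + 15 * δ) * s +
        ((32 * (2 * Θ₁) ^ 4 + 8 * (2 * Θ₁)) * δ + 128 * (2 * Θ₁) ^ 2 * (η + 15 * δ) ^ 2) ≤ C * luscherLambda β L ^ 2) :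
    DynamicCoreClauses k C β (dressedLiftFamily β φ g) := by
  have hm0 : 0 < levelValue su2Rep 1 (oneSiteCoupling β L) 0 := levelValue_su2Rep_pos (L := 1) hB 0
  have hμ : ∀ j : ℕ, 0 ≤ levelValue su2Rep 1 (oneSiteCoupling β L) j := fun j => levelValue_su2Rep_nonneg 1 hB.le j
  refine ⟨fun i => ?_, fun i l hil => ?_⟩
  · have h := o5_clause (C := C) hβ (hv i) hδ0 hδ hm0 (hμ ((i : ℕ) + 1)) (hn i) (hraw i) (hdress i) (hB5 i) hC5
    simpa only [dressedLiftFamily_apply] using h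
  · have h := o6_clause (C := C) hβ (hv i) (hv l) hδ0 hδ hE hs hΘ₁ hη0 (hn i) (hn l) (hraw i) (hdress i) (hraw l) (hdress l)
      (hB6 i l hil) (ho2 i l hil) (hcmp i l) (hcmp l i) (hmis i l) (hmis l i) (htop i) (htop l) hC6
    simpa only [dressedLiftFamily_apply] using h

end Summit.QuantumFields.YangMills.Theorems.FemtoTransferGap.PolyakovLift

end
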